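import Summits.FinalStateConjecture.FinalStateConjecture.Theses.HomotheticSurfaceGravity

set_option linter.dupNamespace false

/-!
# Birth skeleton of piece B `NoTIPCascade` (child of crux `NakedTangentProfile`, stmt-FinalStateConjecture-17353)

Two stubs and the real composition `NoTIPCascade_of`:
* `stub_cascadeCore` — NONEMPTY CORE: the vertices of an antitone sequence of TIPs inside a visible TIP of a maximal
  vacuum Cauchy development of admissible data cannot recede to the data hypersurface (Cauchy surface, local existence
  near every compact part of `Σ`) nor to spatial infinity (exterior stability; the sojourn bounds of the witnessing
  rays): exit ∨ some event lies in every member of the sequence.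
* `stub_endlessInCore` — ENDLESS OBSERVER IN THE CORE: given an event in every member, exit ∨ a future-directed
  timelike curve without future endpoint threads the whole sequence (limit-curve argument; Cauchy stability /
  breakdown criterion excludes ideal points accumulating at an interior event, so the limit object is again an ideal
  point and not a point of `M`).
-/

namespace Summit.FinalStateConjecture.FinalStateConjecture.Cruxes.NakedTangentProfile.FirstNakedPointZorn.BirthB

open Set Filter Function
open scoped Manifold ContDiff Topology
open Literature.Geometry.Lorentzian
open Summit.FinalStateConjecture.FinalStateConjecture.Theses.HomotheticSurfaceGravity

/-- **Stub B1 — nonempty core of a cascade of visible ideal points.** -/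
theorem stub_cascadeCore :
    ∀ (X : Type) [TopologicalSpace X] [ChartedSpace Literature.Geometry.Lorentzian.E3 X] [IsManifold (𝓡 3) ((⊤ : ℕ∞) : WithTop ℕ∞) X] [T2Space X] [SecondCountableTopology X] [ConnectedSpace X], ∀ D ∈ Literature.Geometry.Lorentzian.admissibleVacuumData X, ∀ 𝒟 : Literature.Geometry.Lorentzian.VacuumCauchyDevelopment D, 𝒟.IsMaximal → ∀ W₀ : Set 𝒟.carrier, 𝒟.metric.IsTIP 𝒟.timeOrientation W₀ → (∀ [𝒟.metric.HasLeviCivita], 𝒟.metric.IsVisibleFromInfinity 𝒟.timeOrientation 𝒟.embed 𝒟.normal W₀) → ∀ P : ℕ → Set 𝒟.carrier, (∀ k, 𝒟.metric.IsTIP 𝒟.timeOrientation (P k)) → (∀ k, P k ⊆ W₀) → Antitone P → (∃ (e : Literature.Geometry.Lorentzian.AFEnd X) (F : EuclideanSpace ℝ (Fin 1) → Literature.Geometry.Lorentzian.InitialDataSet (𝓡 3) X), Literature.Geometry.Lorentzian.InitialDataSet.IsTameDataFamily e 1 F ∧ Literature.Geometry.Lorentzian.InitialDataSet.IsImmersedAtZero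 1 F ∧ F 0 = D ∧ Function.Injective F ∧ (∀ c, F c ∈ Literature.Geometry.Lorentzian.admissibleVacuumData X) ∧ ∃ ε : ℝ, 0 < ε ∧ ∀ c, c ≠ 0 → ‖c‖ < ε → ((∃ 𝒟' : Literature.Geometry.Lorentzian.VacuumCauchyDevelopment (F c), 𝒟'.IsMaximal) ∧ ∀ 𝒟' : Literature.Geometry.Lorentzian.VacuumCauchyDevelopment (F c), 𝒟'.IsMaximal → Summit.FinalStateConjecture.HasCompleteNullInfinity 𝒟'.toCauchyDevelopment ∧ ∃ (O : Set 𝒟'.carrier) (d : Literature.Geometry.Lorentzian.FinalStateDecomposition 𝒟'.toSpacetime O 2), (∀ i, Literature.Geometry.Lorentzian.Kerr.IsSubextremal (d.mass i) (d.spin i)) ∧ O = Summit.FinalStateConjecture.exteriorOf 𝒟'.toCauchyDevelopment d.charted ∧ Summit.FinalStateConjecture.RaysStayInClosure 𝒟'.toCauchyDevelopment O ∧ Summit.FinalStateConjecture.HasExhaustiveCharts d ∧ Summit.FinalStateConjecture.IsFutureOriented d)) ∨ ∃ x₀ : 𝒟.carrier, ∀ k, x₀ ∈ P k := by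
  sorry

/-- **Stub B2 — an endless observer in the core.** -/
theorem stub_endlessInCore :
    ∀ (X : Type) [TopologicalSpace X] [ChartedSpace Literature.Geometry.Lorentzian.E3 X] [IsManifold (𝓡 3) ((⊤ : ℕ∞) : WithTop ℕ∞) X] [T2Space X] [SecondCountableTopology X] [ConnectedSpace X], ∀ D ∈ Literature.Geometry.Lorentzian.admissibleVacuumData X, ∀ 𝒟 : Literature.Geometry.Lorentzian.VacuumCauchyDevelopment D, 𝒟.IsMaximal → ∀ W₀ : Set 𝒟.carrier, 𝒟.metric.IsTIP 𝒟.timeOrientation W₀ → (∀ [𝒟.metric.HasLeviCivita], 𝒟.metric.IsVisibleFromInfinity 𝒟.timeOrientation 𝒟.embed 𝒟.normal W₀) → ∀ P : ℕ → Set 𝒟.carrier, (∀ k, 𝒟.metric.IsTIP 𝒟.timeOrientation (P k)) → (∀ k, P k ⊆ W₀) → Antitone P → ∀ x₀ : 𝒟.carrier, (∀ k, x₀ ∈ P k) → (∃ (e : Literature.Geometry.Lorentzian.AFEnd X) (F : EuclideanSpace ℝ (Fin 1) → Literature.Geometry.Lorentzian.InitialDataSet (𝓡 3) X), Literature.Geometry.Lorentzian.InitialDataSet.IsTameDataFamily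 e 1 F ∧ Literature.Geometry.Lorentzian.InitialDataSet.IsImmersedAtZero 1 F ∧ F 0 = D ∧ Function.Injective F ∧ (∀ c, F c ∈ Literature.Geometry.Lorentzian.admissibleVacuumData X) ∧ ∃ ε : ℝ, 0 < ε ∧ ∀ c, c ≠ 0 → ‖c‖ < ε → ((∃ 𝒟' : Literature.Geometry.Lorentzian.VacuumCauchyDevelopment (F c), 𝒟'.IsMaximal) ∧ ∀ 𝒟' : Literature.Geometry.Lorentzian.VacuumCauchyDevelopment (F c), 𝒟'.IsMaximal → Summit.FinalStateConjecture.HasCompleteNullInfinity 𝒟'.toCauchyDevelopment ∧ ∃ (O : Set 𝒟'.carrier) (d : Literature.Geometry.Lorentzian.FinalStateDecomposition 𝒟'.toSpacetime O 2), (∀ i, Literature.Geometry.Lorentzian.Kerr.IsSubextremal (d.mass i) (d.spin i)) ∧ O = Summit.FinalStateConjecture.exteriorOf 𝒟'.toCauchyDevelopment d.charted ∧ Summit.FinalStateConjecture.RaysStayInClosure 𝒟'.toCauchyDevelopment O ∧ Summit.FinalStateConjecture.HasExhaustiveCharts d ∧ Summit.FinalStateConjecture.IsFutureOriented d)) ∨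 ∃ (γ : ℝ → 𝒟.carrier) (s : Set ℝ), s.OrdConnected ∧ 𝒟.metric.IsFutureTimelikeCurveOn 𝒟.timeOrientation γ s ∧ Literature.Geometry.Lorentzian.IsFutureEndless γ s ∧ ∀ k, γ '' s ⊆ P k := by
  sorry

/-- **Piece B from its two stubs** (hypothesis form; no `sorry` here). -/
theorem noTIPCascade_of_stubs :
    (∀ (X : Type) [TopologicalSpace X] [ChartedSpace Literature.Geometry.Lorentzian.E3 X] [IsManifold (𝓡 3) ((⊤ : ℕ∞) : WithTop ℕ∞) X] [T2Space X] [SecondCountableTopology X] [ConnectedSpace X], ∀ D ∈ Literature.Geometry.Lorentzian.admissibleVacuumData X, ∀ 𝒟 : Literature.Geometry.Lorentzian.VacuumCauchyDevelopment D, 𝒟.IsMaximal → ∀ W₀ : Set 𝒟.carrier, 𝒟.metric.IsTIP 𝒟.timeOrientation W₀ → (∀ [𝒟.metric.HasLeviCivita], 𝒟.metric.IsVisibleFromInfinity 𝒟.timeOrientation 𝒟.embed 𝒟.normal W₀) → ∀ P : ℕ → Set 𝒟.carrier, (∀ k, 𝒟.metric.IsTIP 𝒟.timeOrientation (P k)) →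 (∀ k, P k ⊆ W₀) → Antitone P → (∃ (e : Literature.Geometry.Lorentzian.AFEnd X) (F : EuclideanSpace ℝ (Fin 1) → Literature.Geometry.Lorentzian.InitialDataSet (𝓡 3) X), Literature.Geometry.Lorentzian.InitialDataSet.IsTameDataFamily e 1 F ∧ Literature.Geometry.Lorentzian.InitialDataSet.IsImmersedAtZero 1 F ∧ F 0 = D ∧ Function.Injective F ∧ (∀ c, F c ∈ Literature.Geometry.Lorentzian.admissibleVacuumData X) ∧ ∃ ε : ℝ, 0 < ε ∧ ∀ c, c ≠ 0 → ‖c‖ < ε → ((∃ 𝒟' : Literature.Geometry.Lorentzian.VacuumCauchyDevelopment (F c), 𝒟'.IsMaximal) ∧ ∀ 𝒟' : Literature.Geometry.Lorentzian.VacuumCauchyDevelopment (F c), 𝒟'.IsMaximal → Summit.FinalStateConjecture.HasCompleteNullInfinity 𝒟'.toCauchyDevelopment ∧ ∃ (O : Set 𝒟'.carrier) (d : Literature.Geometry.Lorentzian.FinalStateDecomposition 𝒟'.toSpacetime O 2), (∀ i, Literature.Geometry.Lorentzian.Kerr.IsSubextremal (d.mass i) (d.spin i)) ∧ O = Summit.FinalStateConjecture.exteriorOf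 𝒟'.toCauchyDevelopment d.charted ∧ Summit.FinalStateConjecture.RaysStayInClosure 𝒟'.toCauchyDevelopment O ∧ Summit.FinalStateConjecture.HasExhaustiveCharts d ∧ Summit.FinalStateConjecture.IsFutureOriented d)) ∨ ∃ x₀ : 𝒟.carrier, ∀ k, x₀ ∈ P k) →
    (∀ (X : Type) [TopologicalSpace X] [ChartedSpace Literature.Geometry.Lorentzian.E3 X] [IsManifold (𝓡 3) ((⊤ : ℕ∞) : WithTop ℕ∞) X] [T2Space X] [SecondCountableTopology X] [ConnectedSpace X], ∀ D ∈ Literature.Geometry.Lorentzian.admissibleVacuumData X, ∀ 𝒟 : Literature.Geometry.Lorentzian.VacuumCauchyDevelopment D, 𝒟.IsMaximal → ∀ W₀ : Set 𝒟.carrier, 𝒟.metric.IsTIP 𝒟.timeOrientation W₀ → (∀ [𝒟.metric.HasLeviCivita], 𝒟.metric.IsVisibleFromInfinity 𝒟.timeOrientation 𝒟.embed 𝒟.normal W₀) → ∀ P : ℕ → Set 𝒟.carrier, (∀ k, 𝒟.metric.IsTIP 𝒟.timeOrientation (P k)) → (∀ k, P k ⊆ W₀) → Antitone P → ∀ x₀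 : 𝒟.carrier, (∀ k, x₀ ∈ P k) → (∃ (e : Literature.Geometry.Lorentzian.AFEnd X) (F : EuclideanSpace ℝ (Fin 1) → Literature.Geometry.Lorentzian.InitialDataSet (𝓡 3) X), Literature.Geometry.Lorentzian.InitialDataSet.IsTameDataFamily e 1 F ∧ Literature.Geometry.Lorentzian.InitialDataSet.IsImmersedAtZero 1 F ∧ F 0 = D ∧ Function.Injective F ∧ (∀ c, F c ∈ Literature.Geometry.Lorentzian.admissibleVacuumData X) ∧ ∃ ε : ℝ, 0 < ε ∧ ∀ c, c ≠ 0 → ‖c‖ < ε → ((∃ 𝒟' : Literature.Geometry.Lorentzian.VacuumCauchyDevelopment (F c), 𝒟'.IsMaximal) ∧ ∀ 𝒟' : Literature.Geometry.Lorentzian.VacuumCauchyDevelopment (F c), 𝒟'.IsMaximal → Summit.FinalStateConjecture.HasCompleteNullInfinity 𝒟'.toCauchyDevelopment ∧ ∃ (O : Set 𝒟'.carrier) (d : Literature.Geometry.Lorentzian.FinalStateDecomposition 𝒟'.toSpacetime O 2), (∀ i, Literature.Geometry.Lorentzian.Kerr.IsSubextremal (d.mass i) (d.spin i)) ∧ O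 = Summit.FinalStateConjecture.exteriorOf 𝒟'.toCauchyDevelopment d.charted ∧ Summit.FinalStateConjecture.RaysStayInClosure 𝒟'.toCauchyDevelopment O ∧ Summit.FinalStateConjecture.HasExhaustiveCharts d ∧ Summit.FinalStateConjecture.IsFutureOriented d)) ∨ ∃ (γ : ℝ → 𝒟.carrier) (s : Set ℝ), s.OrdConnected ∧ 𝒟.metric.IsFutureTimelikeCurveOn 𝒟.timeOrientation γ s ∧ Literature.Geometry.Lorentzian.IsFutureEndless γ s ∧ ∀ k, γ '' s ⊆ P k) →
    (∀ (X : Type) [TopologicalSpace X] [ChartedSpace Literature.Geometry.Lorentzian.E3 X] [IsManifold (𝓡 3) ((⊤ : ℕ∞) : WithTop ℕ∞) X] [T2Space X] [SecondCountableTopology X] [ConnectedSpace X], ∀ D ∈ Literature.Geometry.Lorentzian.admissibleVacuumData X, ∀ 𝒟 : Literature.Geometry.Lorentzian.VacuumCauchyDevelopment D, 𝒟.IsMaximal → ∀ W₀ : Set 𝒟.carrier, 𝒟.metric.IsTIP 𝒟.timeOrientation W₀ → (∀ [𝒟.metric.HasLeviCivita], 𝒟.metric.IsVisibleFromInfinity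 𝒟.timeOrientation 𝒟.embed 𝒟.normal W₀) → ∀ P : ℕ → Set 𝒟.carrier, (∀ k, 𝒟.metric.IsTIP 𝒟.timeOrientation (P k)) → (∀ k, P k ⊆ W₀) → Antitone P → (∃ (e : Literature.Geometry.Lorentzian.AFEnd X) (F : EuclideanSpace ℝ (Fin 1) → Literature.Geometry.Lorentzian.InitialDataSet (𝓡 3) X), Literature.Geometry.Lorentzian.InitialDataSet.IsTameDataFamily e 1 F ∧ Literature.Geometry.Lorentzian.InitialDataSet.IsImmersedAtZero 1 F ∧ F 0 = D ∧ Function.Injective F ∧ (∀ c, F c ∈ Literature.Geometry.Lorentzian.admissibleVacuumData X) ∧ ∃ ε : ℝ, 0 < ε ∧ ∀ c, c ≠ 0 → ‖c‖ < ε → ((∃ 𝒟' : Literature.Geometry.Lorentzian.VacuumCauchyDevelopment (F c), 𝒟'.IsMaximal) ∧ ∀ 𝒟' : Literature.Geometry.Lorentzian.VacuumCauchyDevelopment (F c), 𝒟'.IsMaximal → Summit.FinalStateConjecture.HasCompleteNullInfinity 𝒟'.toCauchyDevelopment ∧ ∃ (O : Set 𝒟'.carrier) (d : Literature.Geometry.Lorentzian.FinalStateDecomposition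 𝒟'.toSpacetime O 2), (∀ i, Literature.Geometry.Lorentzian.Kerr.IsSubextremal (d.mass i) (d.spin i)) ∧ O = Summit.FinalStateConjecture.exteriorOf 𝒟'.toCauchyDevelopment d.charted ∧ Summit.FinalStateConjecture.RaysStayInClosure 𝒟'.toCauchyDevelopment O ∧ Summit.FinalStateConjecture.HasExhaustiveCharts d ∧ Summit.FinalStateConjecture.IsFutureOriented d)) ∨ ∃ (γ : ℝ → 𝒟.carrier) (s : Set ℝ), s.OrdConnected ∧ 𝒟.metric.IsFutureTimelikeCurveOn 𝒟.timeOrientation γ s ∧ Literature.Geometry.Lorentzian.IsFutureEndless γ s ∧ ∀ k, γ '' s ⊆ P k) := by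
  intro h1 h2 X _ _ _ _ _ _ D hD 𝒟 hmax W₀ hW₀ hvis P hP hPW hanti
  refine Classical.or_iff_not_imp_left.mpr fun hex ↦ ?_
  obtain ⟨x₀, hx₀⟩ := (h1 X D hD 𝒟 hmax W₀ hW₀ hvis P hP hPW hanti).resolve_left hex
  exact (h2 X D hD 𝒟 hmax W₀ hW₀ hvis P hP hPW hanti x₀ hx₀).resolve_left hex

/-- **Piece B by name from the registered stubs** (`sorry` only inside `stub_*`). -/
theorem NoTIPCascade_of :
    (∀ (X : Type) [TopologicalSpace X] [ChartedSpace Literature.Geometry.Lorentzian.E3 X] [IsManifold (𝓡 3) ((⊤ : ℕ∞) : WithTop ℕ∞) X] [T2Space X] [SecondCountableTopology X] [ConnectedSpace X], ∀ D ∈ Literature.Geometry.Lorentzian.admissibleVacuumData X, ∀ 𝒟 : Literature.Geometry.Lorentzian.VacuumCauchyDevelopment D, 𝒟.IsMaximal → ∀ W₀ : Set 𝒟.carrier, 𝒟.metric.IsTIP 𝒟.timeOrientation W₀ → (∀ [𝒟.metric.HasLeviCivita], 𝒟.metric.IsVisibleFromInfinity 𝒟.timeOrientation 𝒟.embed 𝒟.normal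 W₀) → ∀ P : ℕ → Set 𝒟.carrier, (∀ k, 𝒟.metric.IsTIP 𝒟.timeOrientation (P k)) → (∀ k, P k ⊆ W₀) → Antitone P → (∃ (e : Literature.Geometry.Lorentzian.AFEnd X) (F : EuclideanSpace ℝ (Fin 1) → Literature.Geometry.Lorentzian.InitialDataSet (𝓡 3) X), Literature.Geometry.Lorentzian.InitialDataSet.IsTameDataFamily e 1 F ∧ Literature.Geometry.Lorentzian.InitialDataSet.IsImmersedAtZero 1 F ∧ F 0 = D ∧ Function.Injective F ∧ (∀ c, F c ∈ Literature.Geometry.Lorentzian.admissibleVacuumData X) ∧ ∃ ε : ℝ, 0 < ε ∧ ∀ c, c ≠ 0 → ‖c‖ < ε → ((∃ 𝒟' : Literature.Geometry.Lorentzian.VacuumCauchyDevelopment (F c), 𝒟'.IsMaximal) ∧ ∀ 𝒟' : Literature.Geometry.Lorentzian.VacuumCauchyDevelopment (F c), 𝒟'.IsMaximal → Summit.FinalStateConjecture.HasCompleteNullInfinity 𝒟'.toCauchyDevelopment ∧ ∃ (O : Set 𝒟'.carrier) (d : Literature.Geometry.Lorentzian.FinalStateDecomposition 𝒟'.toSpacetime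 O 2), (∀ i, Literature.Geometry.Lorentzian.Kerr.IsSubextremal (d.mass i) (d.spin i)) ∧ O = Summit.FinalStateConjecture.exteriorOf 𝒟'.toCauchyDevelopment d.charted ∧ Summit.FinalStateConjecture.RaysStayInClosure 𝒟'.toCauchyDevelopment O ∧ Summit.FinalStateConjecture.HasExhaustiveCharts d ∧ Summit.FinalStateConjecture.IsFutureOriented d)) ∨ ∃ (γ : ℝ → 𝒟.carrier) (s : Set ℝ), s.OrdConnected ∧ 𝒟.metric.IsFutureTimelikeCurveOn 𝒟.timeOrientation γ s ∧ Literature.Geometry.Lorentzian.IsFutureEndless γ s ∧ ∀ k, γ '' s ⊆ P k) :=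
  noTIPCascade_of_stubs stub_cascadeCore stub_endlessInCore

end Summit.FinalStateConjecture.FinalStateConjecture.Cruxes.NakedTangentProfile.FirstNakedPointZorn.BirthB
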